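import Literature.Probability.DuminilCopinMarkarPanisSlade2026.NearestNeighbourVerdict
import HarnessLib

/-!
# Duminil-Copin–Markar–Panis–Slade (2026): Proposition 4.1 typed without `sSup`, and the
# error-term floor of the nearest-neighbour verdict re-derived from it

CITATION HEADER. Source: H. Duminil-Copin, A. Markar, R. Panis, G. Slade, *A random walk approach
to high-dimensional critical phenomena*, arXiv:2605.21438v2 (21 May 2026), UNREFEREED (bib key
`DuminilCopinMarkarPanisSlade2026RandomWalk`; page numbers = PDF pages of v2). Origin: build `lace`,
unit `b2b-lace-dmps-g2`, answering the cross-check referee's typing remark on the companion modules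
`…DuminilCopinMarkarPanisSlade2026.BlackBox` / `.NearestNeighbourVerdict`: there
`errE J G H β := sSup (errSummand J G H '' Icc 0 β)` ((1.23), p. 8) takes Lean's junk value `0` when
the image is unbounded, so the typed `Proposition41` — which reads (4.2) through `errE` — asserts in
that case `(β - β')·(1 - 0) ≤ 1/χ(β') - 1/χ(β)`, which is MORE than the paper states: in print the
lower bound of (4.2) is vacuous when `E(β) = ∞` (the paper has `E` finite and continuous on
`[0, β_c)`, p. 8: "each of the three functions inside the supremum in (1.23) is continuous in
`t ∈ [0, β_c)` … the supremum `E(β)` is also continuous in `β ∈ [0, β_c)`", so the case does not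
arise in print — but a typed HYPOTHESIS must never be stronger than its source).

WHAT IS HERE (no statement of the paper is asserted; DMPS items enter as HYPOTHESES):

* `Proposition41Eta` — Proposition 4.1 (p. 25, (4.2): "For every `0 ≤ β' ≤ β < β_c`,
  `(β - β')(1 - E(β)) ≤ 1/χ(β') - 1/χ(β) ≤ β - β'`") typed WITHOUT `sSup`: the upper bound verbatim,
  and the lower bound in the form "for every real `η` with `‖H_t‖₁ + ‖|x|₂² H_t‖₁/ξ(t)² ≤ η` for all
  `t ∈ [0, β]`: `(β - β')(1 - η) ≤ 1/χ(β') - 1/χ(β)`". This is EQUIVALENT to print when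
  `E(β) < ∞` (take `η = E(β)`; conversely `E(β) ≤ η` and `β - β' ≥ 0`) and VACUOUS, like print, when
  the summands are unbounded on `[0, β]` — the same junk-free device as `AssumptionII` in `BlackBox`.
* `proposition41Eta_of_proposition41` — the landed `sSup` typing IMPLIES the junk-free one
  (kernel-checked). Hence every theorem below, stated with the hypothesis `Proposition41Eta d`, is at
  least as strong as its `Proposition41` counterpart in `NearestNeighbourVerdict`, and its hypothesis
  is now exactly what p. 25 prints.
* THE FLOOR, junk-free (`summandBound_ge_of_proposition41Eta`): under Proposition 4.1, for any
  admissible `J`, `G ∈ 𝒢` and `H` as in Assumption I, every upper bound `η` of the summands of `E` on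
  `[0, β]` with `0 < β < β_c` satisfies `η ≥ 1 - 1/β` ((4.2) at `β' = 0`: `β(1 - η) ≤ 1/χ(0) - 1/χ(β)
  ≤ 1`, using `χ(0) = 1`, `χ(β) ≥ 0`). With a `BddAbove` guard this is `E(β) ≥ 1 - 1/β`
  (`errE_ge_of_proposition41Eta`).
* NEAREST-NEIGHBOUR PERCOLATION (`exists_errSummand_gt_of_proposition41Eta`,
  `exists_errSummand_Hperc_gt`): since `β_c = 2d·p_c ≥ 2d/(2d-1)` (`betaCPerc_ge`), for every
  `η < 1/(2d)` SOME `t ∈ [0, β_c)` has summand `> η` — the junk-free content of the census line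
  "`E(β_c⁻) ≥ 1/(2d) ≫ 2⁻⁹`" — for EVERY `H` with which `Gperc` obeys Assumption I, in particular the
  `H` of (6.40) under `PercolationAssumptionI d`.
* A SECOND KERNEL PATH TO THE VERDICT (`not_percolationAssumptionII_of_betaOf_eq`,
  `not_percolationAssumptionII_of_theorem16Conclusion`): if `β(δ) = β_c` — the conclusion of
  Theorem 1.6 (p. 9) — then Assumption II at any `δ ≤ 1/(2d)` is refuted by Proposition 4.1 alone
  (no Theorem 1.7, no `χ(β_c) = ∞`); so `Proposition41Eta d`, `Theorem16Conclusion d 1 c C ε δ` and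
  `PercolationAssumptionI d` together refute `PercolationAssumptionII d δ` for `δ ≤ 1/(2d)`, and at
  the paper's constructed `𝛅 ≤ 2⁻⁹` for `3 ≤ d ≤ 256` (`verdict_asConstructed'`). The first path
  (`NearestNeighbourVerdict.not_percolationAssumptionII`, via Theorem 1.7 (1.27)) does not mention
  `Proposition41` or `errE` at all and is unaffected by the remark above.
-/

noncomputable section

open Filter
open _root_.Topology

namespace Literature.Probability.DuminilCopinMarkarPanisSlade2026

open Literature.Probability.LatticeModels (Site)
open Literature.Probability.Percolation

variable {d : ℕ}

/-! ## Proposition 4.1 without `sSup` -/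

/-- **Proposition 4.1** (p. 25, (4.2)), typed junk-free: "For every `0 ≤ β' ≤ β < β_c`,
`(β - β')(1 - E(β)) ≤ 1/χ(β') - 1/χ(β) ≤ β - β'`", with `E(β) = sup_{0 ≤ t ≤ β}(‖H_t‖₁ +
‖|x|₂² H_t‖₁/ξ(t)²)` ((4.1)) read as "every upper bound `η` of the summands on `[0, β]`" (equivalent
for `E(β) < ∞`, vacuous otherwise, exactly as in print). Hypotheses as in §4 p. 25: "`J` is
admissible, that `G ∈ 𝒢`, and that `J` and `G` satisfy Assumption I … `d > 2`".
[claim: DuminilCopinMarkarPanisSlade2026RandomWalk, status: under-review] -/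
def Proposition41Eta (d : ℕ) : Prop :=
  2 < d → ∀ (βc : ℝ) (J : Site d → ℝ) (G H : ℝ → Site d → ℝ),
    AdmissibleKernel J → InClassG βc G → AssumptionI βc J G H →
      ∀ β' β : ℝ, 0 ≤ β' → β' ≤ β → β < βc →
        1 / chi G β' - 1 / chi G β ≤ β - β' ∧
          ∀ η : ℝ, (∀ t, 0 ≤ t → t ≤ β → errSummand J G H t ≤ η) →
            (β - β') * (1 - η) ≤ 1 / chi G β' - 1 / chi G β

/-- A bound on the summands over `[0, β]` bounds `E(β)` (`sSup` of a non-empty set). [folklore] -/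
theorem errE_le_of_summand_le {J : Site d → ℝ} {G H : ℝ → Site d → ℝ} {β η : ℝ} (hβ : 0 ≤ β)
    (hη : ∀ t, 0 ≤ t → t ≤ β → errSummand J G H t ≤ η) : errE J G H β ≤ η := by
  unfold errE
  refine csSup_le ((Set.nonempty_Icc.mpr hβ).image _) ?_
  rintro _ ⟨t, ⟨ht0, htβ⟩, rfl⟩
  exact hη t ht0 htβ

/-- Conversely, when the summands are bounded on `[0, β]`, `E(β)` bounds each of them. [folklore] -/
theorem errSummand_le_errE {J : Site d → ℝ} {G H : ℝ → Site d → ℝ} {β t : ℝ} (ht0 : 0 ≤ t)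
    (ht : t ≤ β) (hB : BddAbove (errSummand J G H '' Set.Icc 0 β)) :
    errSummand J G H t ≤ errE J G H β :=
  le_csSup hB ⟨t, ⟨ht0, ht⟩, rfl⟩

/-- The landed `sSup` typing of Proposition 4.1 implies the junk-free one: given a bound `η` of the
summands on `[0, β]`, `E(β) ≤ η` and `β - β' ≥ 0`. [folklore] -/
theorem proposition41Eta_of_proposition41 (h : Proposition41 d) : Proposition41Eta d := by
  intro hd βc J G H hJ hG hA β' β hβ' hle hβ
  obtain ⟨h1, h2⟩ := h hd βc J G H hJ hG hA β' β hβ' hle hβ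
  refine ⟨h2, fun η hη => le_trans ?_ h1⟩
  have hE : errE J G H β ≤ η := errE_le_of_summand_le (hβ'.trans hle) hη
  exact mul_le_mul_of_nonneg_left (by linarith) (by linarith)

/-! ## The floor `η ≥ 1 - 1/β`, for any model -/

/-- **The floor, junk-free.** Under Proposition 4.1: for admissible `J`, `G ∈ 𝒢`, `H` as in
Assumption I and `0 < β < β_c`, every `η` bounding `‖H_t‖₁ + ‖|x|₂² H_t‖₁/ξ(t)²` on `[0, β]` obeys
`η ≥ 1 - 1/β` — (4.2) with `β' = 0`, `χ(0) = ‖δ₀‖₁ = 1` and `1/χ(β) ≥ 0` (`G_β ≥ 0`). [folklore] -/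
theorem summandBound_ge_of_proposition41Eta (hd : 2 < d) (h41 : Proposition41Eta d) {βc : ℝ}
    {J : Site d → ℝ} {G H : ℝ → Site d → ℝ} (hJ : AdmissibleKernel J) (hG : InClassG βc G)
    (hAI : AssumptionI βc J G H) {β η : ℝ} (hβ0 : 0 < β) (hβ : β < βc)
    (hη : ∀ t, 0 ≤ t → t ≤ β → errSummand J G H t ≤ η) : 1 - 1 / β ≤ η := by
  obtain ⟨-, h⟩ := h41 hd βc J G H hJ hG hAI 0 β le_rfl hβ0.le hβ
  have h := h η hη
  rw [chi_zero_of_inClassG hG] at h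
  have hχ : 0 ≤ 1 / chi G β :=
    one_div_nonneg.mpr (tsum_nonneg fun x => hG.nonneg β hβ0.le hβ x)
  have h2 : β * (1 - η) ≤ 1 := by nlinarith
  have h3 : 1 - η ≤ 1 / β := by
    rw [le_div_iff₀ hβ0]; nlinarith
  linarith

/-- The `errE` form under an explicit boundedness guard: if the summands are bounded on `[0, β]`
(`E(β) < ∞`, as the paper has it, p. 8), then `E(β) ≥ 1 - 1/β`. [folklore] -/
theorem errE_ge_of_proposition41Eta (hd : 2 < d) (h41 : Proposition41Eta d) {βc : ℝ}
    {J : Site d → ℝ} {G H : ℝ → Site d → ℝ} (hJ : AdmissibleKernel J) (hG : InClassG βc G)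
    (hAI : AssumptionI βc J G H) {β : ℝ} (hβ0 : 0 < β) (hβ : β < βc)
    (hB : BddAbove (errSummand J G H '' Set.Icc 0 β)) : 1 - 1 / β ≤ errE J G H β :=
  summandBound_ge_of_proposition41Eta hd h41 hJ hG hAI hβ0 hβ
    fun _ ht0 ht => errSummand_le_errE ht0 ht hB

/-! ## Nearest-neighbour percolation: the summands exceed every `η < 1/(2d)` below `β_c` -/

/-- For nearest-neighbour percolation (`β_c = 2d·p_c ≥ 2d/(2d-1)`, `betaCPerc_ge`) and ANY `H` with
which `Gperc` obeys Definition 1.3 and Assumption I: for every `η < 1/(2d)` some `t ∈ [0, β_c)` has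
`‖H_t‖₁ + ‖|x|₂² H_t‖₁/ξ(t)² > η`. (Pick `β ∈ (1 ∨ 1/(1-η), β_c)`; a uniform bound `η` on `[0, β]`
would contradict `η ≥ 1 - 1/β`.) [folklore] -/
theorem exists_errSummand_gt_of_proposition41Eta (hd : 2 < d) (h41 : Proposition41Eta d)
    {H : ℝ → Site d → ℝ} (hG : InClassG (betaCPerc d) (Gperc d))
    (hAI : AssumptionI (betaCPerc d) (nnKernel d) (Gperc d) H) {η : ℝ} (hη : η < 1 / (2 * d)) :
    ∃ t : ℝ, 0 ≤ t ∧ t < betaCPerc d ∧ η < errSummand (nnKernel d) (Gperc d) H t := by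
  have hd1 : 1 ≤ d := by omega
  have hdR : (2 : ℝ) < d := by exact_mod_cast hd
  have hβge := betaCPerc_ge (d := d) hd1
  have hfloor := one_sub_inv_betaCPerc_ge (d := d) hd1
  have hβc1 : 1 < betaCPerc d := by
    have : (1 : ℝ) < 2 * d / (2 * d - 1) := by
      rw [lt_div_iff₀ (by linarith)]; linarith
    linarith
  have hη1 : η < 1 := lt_of_lt_of_le hη (by rw [div_le_one (by positivity)]; linarith)
  have h1η : 0 < 1 - η := by linarith
  have hthr : 1 / (1 - η) < betaCPerc d := by
    rw [div_lt_iff₀ h1η]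
    have hβpos : 0 < betaCPerc d := by linarith
    have : 1 / betaCPerc d < 1 - η := by linarith
    rw [div_lt_iff₀ hβpos] at this
    linarith
  set β := (max 1 (1 / (1 - η)) + betaCPerc d) / 2 with hβdef
  have hmax_lt : max 1 (1 / (1 - η)) < betaCPerc d := max_lt hβc1 hthr
  have hβ0 : 0 < β := by
    have : (0 : ℝ) < max 1 (1 / (1 - η)) := lt_of_lt_of_le one_pos (le_max_left _ _)
    rw [hβdef]; linarith
  have hβlt : β < betaCPerc d := by rw [hβdef]; linarith
  have hβgt : 1 / (1 - η) < β := by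
    have := le_max_right 1 (1 / (1 - η))
    rw [hβdef]; linarith
  by_contra hne
  push Not at hne
  have hbound : ∀ t, 0 ≤ t → t ≤ β → errSummand (nnKernel d) (Gperc d) H t ≤ η :=
    fun t ht0 ht => hne t ht0 (lt_of_le_of_lt ht hβlt)
  have hge := summandBound_ge_of_proposition41Eta hd h41 (nnKernel_admissible hd1) hG hAI hβ0 hβlt
    hbound
  rw [div_lt_iff₀ h1η] at hβgt
  have : 1 / β < 1 - η := by
    rw [div_lt_iff₀ hβ0]; linarith
  linarith

/-- The `H` of (6.40) in particular, with `PercolationAssumptionI d` (DMPS §6.3) as the hypothesis.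
[folklore] -/
theorem exists_errSummand_Hperc_gt (hd : 2 < d) (h41 : Proposition41Eta d)
    (hI : PercolationAssumptionI d) {η : ℝ} (hη : η < 1 / (2 * d)) :
    ∃ t : ℝ, 0 ≤ t ∧ t < betaCPerc d ∧ η < errSummand (nnKernel d) (Gperc d) (Hperc d) t := by
  obtain ⟨hG, hAI⟩ := hI (by omega)
  exact exists_errSummand_gt_of_proposition41Eta hd h41 hG hAI hη

/-! ## A second kernel path to the verdict: Theorem 1.6's `β(δ) = β_c` + Proposition 4.1 -/

/-- If `β(δ) = β_c` (the conclusion of Theorem 1.6, p. 9) then, for `δ ≤ 1/(2d)`, Assumption II for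
nearest-neighbour percolation — "some `η < δ` bounds the summands of `E` on `[0, β(δ)] ∩ [0, β_c)`"
— is refuted by Proposition 4.1 alone. [folklore] -/
theorem not_percolationAssumptionII_of_betaOf_eq (hd : 2 < d) (h41 : Proposition41Eta d)
    (hI : PercolationAssumptionI d) {δ : ℝ} (hδ : δ ≤ 1 / (2 * d))
    (hβ : betaOf (betaCPerc d) (nnKernel d) (Gperc d) (Hperc d) δ = betaCPerc d) :
    ¬ PercolationAssumptionII d δ := by
  rintro ⟨η, hηδ, hη⟩
  obtain ⟨t, ht0, htc, hηt⟩ := exists_errSummand_Hperc_gt hd h41 hI (lt_of_lt_of_le hηδ hδ)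
  have := hη t ht0 (by rw [hβ]; exact htc.le) htc
  linarith

/-- Hence `Proposition41Eta d` (Assumption I only), the conclusion of Theorem 1.6 at ratio constant
`c₀ = 1` (`Theorem16Conclusion d 1 c C ε δ`: Assumptions I–II at `δ` give `β(δ) = β_c`) and DMPS's
claim that nearest-neighbour percolation obeys Definition 1.3 / Assumption I with the `H` of (6.40)
(`PercolationAssumptionI d`) together REFUTE Assumption II at every `δ ≤ 1/(2d)` — without Theorem 1.7
and without `χ(β_c) = ∞`. [folklore] -/
theorem not_percolationAssumptionII_of_theorem16Conclusion (hd : 2 < d) (h41 : Proposition41Eta d)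
    {c C ε δ : ℝ} (h16 : Theorem16Conclusion d 1 c C ε δ) (hI : PercolationAssumptionI d)
    (hδ : δ ≤ 1 / (2 * d)) : ¬ PercolationAssumptionII d δ := by
  intro hII
  have hd1 : 1 ≤ d := by omega
  obtain ⟨hG, hAI⟩ := hI (by omega)
  obtain ⟨hβ, -⟩ := h16 (betaCPerc d) (nnKernel d) (Gperc d) (Hperc d) (nnKernel_admissible hd1)
    (kernelRatio_nnKernel hd1) hG hAI hII
  exact not_percolationAssumptionII_of_betaOf_eq hd h41 hI hδ hβ hII

/-- At the paper's constructed small parameter (`𝛅 ≤ δ_reg = 2⁻⁹`, `Theorem15AsConstructed`), second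
path: for `3 ≤ d ≤ 256`, Proposition 4.1 + Theorems 1.5–1.6 as constructed + `PercolationAssumptionI`
give, for every `ε ∈ (0,1)`, a `𝛅` at which Theorems 1.5/1.6 hold and nearest-neighbour percolation
violates Assumption II. [folklore] -/
theorem verdict_asConstructed' (hd : 2 < d) (hd' : d ≤ 256) (h41 : Proposition41Eta d)
    (h : Theorem15AsConstructed d) (hI : PercolationAssumptionI d) :
    ∃ c C : ℝ, 0 < c ∧ 0 < C ∧ ∀ ε : ℝ, 0 < ε → ε < 1 →
      ∃ δ : ℝ, 0 < δ ∧ δ ≤ deltaReg ∧ Theorem15Conclusion d 1 c C ε δ ∧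
        Theorem16Conclusion d 1 c C ε δ ∧ ¬ PercolationAssumptionII d δ := by
  have hd1 : 1 ≤ d := by omega
  obtain ⟨c, C, hc, hC, hall⟩ := h hd 1 one_pos le_rfl
  refine ⟨c, C, hc, hC, fun ε hε hε1 => ?_⟩
  obtain ⟨δ, hδ0, hδreg, hδhalf, h15, h16, h17⟩ := hall ε hε hε1
  exact ⟨δ, hδ0, hδreg, h15, h16, not_percolationAssumptionII_of_theorem16Conclusion hd h41 h16 hI
    (hδreg.trans (deltaReg_le_inv_two_mul hd1 hd'))⟩

end Literature.Probability.DuminilCopinMarkarPanisSlade2026
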